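import Mathlib
import Literature.Geometry.Symplectic.JHolomorphicRegularityHolder
import Summits.SmoothPoincare4.SmoothPoincare4.Theorems.SullivanDualTameOrBrodyR4CoreAChartImplicit
import Summits.SmoothPoincare4.SmoothPoincare4.Theorems.SullivanDualTameOrBrodyR4HelperZerosAnalytic
import Summits.SmoothPoincare4.SmoothPoincare4.Theorems.SullivanDualTameOrBrodyR4HelperZerosMember
import Summits.SmoothPoincare4.SmoothPoincare4.Theorems.SullivanDualTameOrBrodyR4HelperMemberToZero
import Summits.SmoothPoincare4.SmoothPoincare4.Theorems.SullivanDualTameOrBrodyR4HelperGraphSmall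
import Summits.SmoothPoincare4.SmoothPoincare4.Theorems.SullivanDualTameOrBrodyR4HelperFamilyHigherOrder
import Summits.SmoothPoincare4.SmoothPoincare4.Theorems.SullivanDualTameOrBrodyR4HelperNowhereTangentCentre

/-!
# CORE-A of crux `TameOrBrodyR4` (stmt-SmoothPoincare4-7826), line `Sketch`: the local family at a
# member (lead c6, layer A8)

`helper_familyAt`: at every pencil member `u₀` (value `b₀`) with chart data `𝒞` there are `ε > 0`
and a family `Φ : ℂ → ℂ → ℝ⁴` — the order-`0` implicit function of the vorticity map read through
the chart, `Φ b = u₀ + Ψ((0, b - b₀) + T(χ₁ γ(b - b₀)))` — with: `Φ b₀ = u₀`; every `Φ b`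
(`b ∈ ball b₀ ε`) a member of value `b` (`helper_zerosAnalytic`, elliptic regularity
`contDiff_of_isJHolomorphicFlat_of_holder`, `helper_zerosMember`); joint `C^m`-smoothness near `b₀`
for every `m` (`helper_familyHigherOrder`); nowhere tangent at the centre
(`helper_nowhereTangentCentre`); `Φ b → u₀` as `b → b₀` in the norms of the uniqueness statement
(`helper_graphSmall`); and ABSORPTION: every member of value `b ∈ ball b₀ ε` close to `u₀` is `Φ b`
(`helper_memberToZero` + uniqueness of the implicit function).
-/

-- the registered namespace `Summit.SmoothPoincare4.SmoothPoincare4.…` repeats a component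
set_option linter.dupNamespace false

noncomputable section

open scoped ContDiff Topology NNReal
open Filter Set Function Metric Literature.Analysis.Complex Literature.Analysis.FunctionSpaces
  Literature.Analysis.Calculus Literature.Geometry.Symplectic

namespace Summit.SmoothPoincare4.SmoothPoincare4.Cruxes.TameOrBrodyR4.Sketch

namespace CoreA


namespace ChartData

variable {J : (EuclideanSpace ℝ (Fin 4)) → (EuclideanSpace ℝ (Fin 4)) →L[ℝ] (EuclideanSpace ℝ (Fin 4))} {R : ℝ} {P Q : (EuclideanSpace ℝ (Fin 4)) →L[ℝ] ℂ} {eP eQ : ℂ →L[ℝ] (EuclideanSpace ℝ (Fin 4))} {b₀ : ℂ}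
  {u₀ : ℂ → (EuclideanSpace ℝ (Fin 4))} (𝒞 : ChartData J R P Q eP eQ b₀ u₀)
  {r : ℝ≥0} (hr0 : 0 < r) (hr1 : r < 1) (hJs : ContDiff ℝ ∞ J) (hu₀s : ContDiff ℝ ∞ u₀)

/-- The graph part of the family is `Ψ · W(b - b₀, γ(b - b₀))` with `W` the order-`0` section. -/
theorem fam_eq (γ : ℂ → ContDiffHolderFunction ℂ (ℂ × ℂ) 0 r) (b ξ : ℂ) :
    u₀ ξ + 𝒞.Ψ ξ (((0 : ℂ), b - b₀) +
        cauchyTransformAlong (1 : ℂ) (fun w => 𝒞.χ₁ w • γ (b - b₀) w) ξ) =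
      u₀ ξ + 𝒞.Ψ ξ ((𝒞.vorticity hr0 hr1 hJs hu₀s 0).W (b - b₀, γ (b - b₀)) ξ) := by
  rw [coe_W]

include hr0 hr1 hJs hu₀s in
/-- The Cauchy transform of the zero density vanishes (through the linear operator `𝒯`). -/
theorem cauchyTransform_zero_density (x : ℂ) :
    cauchyTransformAlong (1 : ℂ) (fun w => 𝒞.χ₁ w • (0 : ContDiffHolderFunction ℂ (ℂ × ℂ) 0 r) w) x
      = 0 := by
  rw [← 𝒞.vorticity_𝒯_apply hr0 hr1 hJs hu₀s (k := 0), map_zero]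
  rfl

include hr0 hr1 hJs hu₀s in
/-- At the centre the family is `u₀` (when `γ 0 = 0`). -/
theorem fam_centre (γ : ℂ → ContDiffHolderFunction ℂ (ℂ × ℂ) 0 r) (hγ0 : γ 0 = 0) :
    (fun ξ => u₀ ξ + 𝒞.Ψ ξ (((0 : ℂ), b₀ - b₀) +
        cauchyTransformAlong (1 : ℂ) (fun w => 𝒞.χ₁ w • γ (b₀ - b₀) w) ξ)) = u₀ := by
  funext ξ
  simp only [sub_self, hγ0]
  rw [𝒞.cauchyTransform_zero_density hr0 hr1 hJs hu₀s ξ]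
  simp [Prod.mk_zero_zero]

/-- Norm control of the order-`0` section `W(β, γ β)` near `β = 0`: for `γ` continuous at `0`
with `γ 0 = 0`, `‖W(β, γ β)‖ → 0`. -/
theorem exists_norm_W_lt (γ : ℂ → ContDiffHolderFunction ℂ (ℂ × ℂ) 0 r) (hγc : ContinuousAt γ 0)
    (hγ0 : γ 0 = 0) {t : ℝ} (ht : 0 < t) :
    ∃ ε' > (0 : ℝ), ∀ β : ℂ, ‖β‖ < ε' →
      ‖(𝒞.vorticity hr0 hr1 hJs hu₀s 0).W (β, γ β)‖ < t := by
  set D := 𝒞.vorticity hr0 hr1 hJs hu₀s 0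
  have hWc : ContinuousAt (fun β : ℂ => D.W (β, γ β)) 0 :=
    D.W.continuous.continuousAt.comp (continuousAt_id.prodMk hγc)
  have h0 : D.W (0, γ 0) = 0 := by rw [hγ0]; exact map_zero _
  obtain ⟨ε', hε', h⟩ := Metric.continuousAt_iff.mp hWc t ht
  refine ⟨ε', hε', fun β hβ => ?_⟩
  have := h (x := β) (by simpa [dist_eq_norm] using hβ)
  simpa [h0, dist_eq_norm] using this

end ChartData

end CoreA


/-- **Registered helper `helper_familyAt`: the local family at a member.** See the module
docstring. -/
theorem helper_familyAt (J : (EuclideanSpace ℝ (Fin 4)) → (EuclideanSpace ℝ (Fin 4)) →L[ℝ] (EuclideanSpace ℝ (Fin 4))) (R : ℝ) (P Q : (EuclideanSpace ℝ (Fin 4)) →L[ℝ] ℂ) (eP eQ : ℂ →L[ℝ] (EuclideanSpace ℝ (Fin 4)))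
    (hR : 0 < R) (hJs : ContDiff ℝ ∞ J) (hJ2 : ∀ x v, J x (J x v) = -v)
    (hPQ : IsCoordFrame P Q eP eQ)
    (hJP : ∀ x : (EuclideanSpace ℝ (Fin 4)), R ≤ ‖x‖ → ∀ v, P (J x v) = Complex.I * P v)
    (hJQ : ∀ x : (EuclideanSpace ℝ (Fin 4)), R ≤ ‖x‖ → ∀ v, Q (J x v) = Complex.I * Q v)
    {r : ℝ≥0} (hr0 : 0 < r) (hr1 : r < 1)
    (b₀ : ℂ) (u₀ : ℂ → (EuclideanSpace ℝ (Fin 4))) (hu₀ : IsPencilMember J R P Q b₀ u₀)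
    (𝒞 : CoreA.ChartData J R P Q eP eQ b₀ u₀) :
    ∃ ε > (0 : ℝ), ∃ Φ : ℂ → ℂ → (EuclideanSpace ℝ (Fin 4)),
      Φ b₀ = u₀ ∧
      (∀ b ∈ ball b₀ ε, IsPencilMember J R P Q b (Φ b)) ∧
      (∀ m : ℕ, ∃ ε' > (0 : ℝ), ContDiffOn ℝ m (fun p : ℂ × ℂ => Φ p.1 p.2) (ball b₀ ε' ×ˢ univ)) ∧
      (∀ ξ β ζ : ℂ, fderiv ℝ (fun b' => Φ b' ξ) b₀ β = fderiv ℝ u₀ ξ ζ → β = 0) ∧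
      (∀ θ > (0 : ℝ), ∀ ρ > (0 : ℝ), ∃ ε' > (0 : ℝ), ∀ b ∈ ball b₀ ε',
        (∀ ξ, ‖Φ b ξ - u₀ ξ‖ ≤ θ) ∧
        (∀ ξ ∈ closedBall (0 : ℂ) ρ, ‖fderiv ℝ (Φ b) ξ - fderiv ℝ u₀ ξ‖ ≤ θ) ∧
        (∀ ξ ∈ closedBall (0 : ℂ) ρ, ∀ ξ' ∈ closedBall (0 : ℂ) ρ,
          ‖(fderiv ℝ (Φ b) ξ - fderiv ℝ u₀ ξ) - (fderiv ℝ (Φ b) ξ' - fderiv ℝ u₀ ξ')‖ ≤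
            θ * ‖ξ - ξ'‖ ^ (r : ℝ))) ∧
      (∃ θ > (0 : ℝ), ∀ b ∈ ball b₀ ε, ∀ u : ℂ → (EuclideanSpace ℝ (Fin 4)), IsPencilMember J R P Q b u →
        (∀ ξ, ‖u ξ - u₀ ξ‖ ≤ θ) →
        (∀ ξ ∈ closedBall (0 : ℂ) (𝒞.ρ₁ + 3), ‖fderiv ℝ u ξ - fderiv ℝ u₀ ξ‖ ≤ θ) →
        (∀ ξ ∈ closedBall (0 : ℂ) (𝒞.ρ₁ + 3), ∀ ξ' ∈ closedBall (0 : ℂ) (𝒞.ρ₁ + 3),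
          ‖(fderiv ℝ u ξ - fderiv ℝ u₀ ξ) - (fderiv ℝ u ξ' - fderiv ℝ u₀ ξ')‖ ≤
            θ * ‖ξ - ξ'‖ ^ (r : ℝ)) → u = Φ b) := by
  obtain ⟨hu₀s, hu₀J, -, -, -, -, -, -⟩ := id hu₀
  -- the order-0 implicit function of the vorticity map of the chart
  obtain ⟨ε₀, hε₀, δ₀, hδ₀, γ, hγs, hγ0, -, hγz, hγuniq⟩ :=
    helper_chartImplicitFunction J R P Q eP eQ hR hJs hJ2 hPQ hJP hJQ hr0 hr1 b₀ u₀ hu₀ 𝒞 0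
  have hγc : ContinuousAt γ 0 :=
    (hγs.continuousOn.continuousAt (isOpen_ball.mem_nhds (mem_ball_self hε₀)))
  set D := 𝒞.vorticity hr0 hr1 hJs hu₀.1 0 with hD
  -- the zero equation of `(β, γ β)` in the registered pointwise form
  have hzero : ∀ β ∈ ball (0 : ℂ) ε₀, ∀ x : ℂ, γ β x + 𝒞.χ x • (1 / 2 : ℝ) •
      (𝒞.A x (((0 : ℂ), β) + cauchyTransformAlong (1 : ℂ) (fun w => 𝒞.χ₁ w • γ β w) x) +
        𝒞.Ψinv x ((J (u₀ x + 𝒞.Ψ x (((0 : ℂ), β) +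
            cauchyTransformAlong (1 : ℂ) (fun w => 𝒞.χ₁ w • γ β w) x)) - J (u₀ x))
          (fderiv ℝ u₀ x Complex.I + (fderiv ℝ 𝒞.Ψ x Complex.I)
            (((0 : ℂ), β) + cauchyTransformAlong (1 : ℂ) (fun w => 𝒞.χ₁ w • γ β w) x) +
            𝒞.Ψ x (fderiv ℝ (fun y => ((0 : ℂ), β) +
              cauchyTransformAlong (1 : ℂ) (fun w => 𝒞.χ₁ w • γ β w) y) x Complex.I)))) = 0 := by
    intro β hβ x
    have h := congrArg (fun f : ContDiffHolderFunction ℂ (ℂ × ℂ) 0 r => f x) (hγz β hβ)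
    simp only [ContDiffHolderFunction.coe_zero, Pi.zero_apply] at h
    rwa [helper_chartVorticityApply] at h
  -- the member package: ZM2's θ₂, ZM1's θ₁
  obtain ⟨θ₂, hθ₂, hZM2⟩ := helper_zerosMember J R P Q eP eQ hR hJs hJ2 hPQ hJP hJQ b₀ u₀ hu₀ 𝒞
  obtain ⟨θ₁, hθ₁, hZM1⟩ :=
    helper_zerosAnalytic J R P Q eP eQ hR hJs hJ2 hPQ hJP hJQ hr0 hr1 b₀ u₀ hu₀ 𝒞 θ₂ hθ₂
  -- `‖γ β‖ < θ₁` near `0`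
  obtain ⟨ε₁, hε₁, hγsmall⟩ : ∃ ε₁ > (0 : ℝ), ∀ β : ℂ, ‖β‖ < ε₁ → ‖γ β‖ < θ₁ := by
    have h := hγc
    rw [Metric.continuousAt_iff] at h
    obtain ⟨ε₁, hε₁, h⟩ := h θ₁ hθ₁
    exact ⟨ε₁, hε₁, fun β hβ => by simpa [hγ0, dist_eq_norm] using h (by simpa [dist_eq_norm] using hβ)⟩
  -- absorption scale: MZ with `ε := δ₀ / 2`
  obtain ⟨θM, hθM, hMZ⟩ := helper_memberToZero J R P Q eP eQ hR hJs hJ2 hPQ hJP hJQ hr0 hr1 b₀ u₀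
    hu₀ 𝒞 (δ₀ / 2) (by positivity)
  -- the radius
  set ε := min (min ε₀ ε₁) (min (min θ₁ θ₂) θM) with hε_def
  have hε : 0 < ε := by positivity
  have hεε₀ : ε ≤ ε₀ := (min_le_left _ _).trans (min_le_left _ _)
  have hεε₁ : ε ≤ ε₁ := (min_le_left _ _).trans (min_le_right _ _)
  have hεθ₁ : ε ≤ θ₁ := (min_le_right _ _).trans ((min_le_left _ _).trans (min_le_left _ _))
  have hεθ₂ : ε ≤ θ₂ := (min_le_right _ _).trans ((min_le_left _ _).trans (min_le_right _ _))
  have hεθM : ε ≤ θM := (min_le_right _ _).trans (min_le_right _ _)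
  refine ⟨ε, hε, fun b ξ => u₀ ξ + 𝒞.Ψ ξ (((0 : ℂ), b - b₀) +
    cauchyTransformAlong (1 : ℂ) (fun w => 𝒞.χ₁ w • γ (b - b₀) w) ξ),
    𝒞.fam_centre hr0 hr1 hJs hu₀.1 γ hγ0, ?_, ?_, ?_, ?_, ?_⟩
  · -- members
    intro b hb
    rw [mem_ball, dist_eq_norm] at hb
    set β := b - b₀ with hβ_def
    have hβε₀ : β ∈ ball (0 : ℂ) ε₀ := by rw [mem_ball, dist_zero_right]; exact hb.trans_le hεε₀
    obtain ⟨hC1, hH, hflat, hQ, hP, hW0, hW1⟩ := hZM1 β (γ β) (hb.trans_le hεθ₁)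
      (hγsmall β (hb.trans_le hεε₁)) (hzero β hβε₀)
    have hsmooth := contDiff_of_isJHolomorphicFlat_of_holder hr0 hr1
      (cauchyTransformHolderApriori_of_lt_one (ℂ × ℂ) hr0 hr1) J hJs hJ2 _ hC1 hflat hH
    have hmem := hZM2 β (fun ξ => ((0 : ℂ), β) +
      cauchyTransformAlong (1 : ℂ) (fun w => 𝒞.χ₁ w • γ β w) ξ) (hb.trans_le hεθ₂) ?_ hW0 hW1
      hsmooth hflat hQ hP
    · have hbb : b₀ + β = b := by rw [hβ_def]; abel
      rw [hbb] at hmem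
      exact hmem
    · -- `W` is `C¹`: it is the order-0 section, a member of `C^{1,r}_b`
      have := (D.W (β, γ β)).contDiff
      rw [CoreA.ChartData.coe_W] at this
      exact this
  · -- higher order
    intro m
    exact helper_familyHigherOrder J R P Q eP eQ hR hJs hJ2 hPQ hJP hJQ hr0 hr1 b₀ u₀ hu₀ 𝒞 ε₀ δ₀
      hε₀ hδ₀ γ hγs hγ0 hγuniq m
  · -- nowhere tangent at the centre
    exact helper_nowhereTangentCentre J R P Q eP eQ hR hJs hJ2 hPQ hJP hJQ hr0 hr1 b₀ u₀ hu₀ 𝒞 ε₀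
      hε₀ γ hγs hγ0 hγz
  · -- smallness of `Φ b - u₀ = Ψ · W(b - b₀)`
    intro θ hθ ρ hρ
    obtain ⟨K, hK, hGS⟩ := helper_graphSmall J R P Q eP eQ b₀ u₀ 𝒞 hr0 hr1 ρ hρ
    obtain ⟨ε', hε', hWsmall⟩ := 𝒞.exists_norm_W_lt hr0 hr1 hJs hu₀.1 γ hγc hγ0
      (t := θ / K) (by positivity)
    refine ⟨ε', hε', fun b hb => ?_⟩
    rw [mem_ball, dist_eq_norm] at hb
    set W := D.W (b - b₀, γ (b - b₀)) with hW_def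
    have hWK : K * ‖W‖ ≤ θ := by
      have := (hWsmall (b - b₀) hb).le
      calc K * ‖W‖ ≤ K * (θ / K) := by gcongr
        _ = θ := by field_simp
    obtain ⟨hG0, hG1, hG2⟩ := hGS W
    have hfam : (fun ξ => u₀ ξ + 𝒞.Ψ ξ (((0 : ℂ), b - b₀) +
        cauchyTransformAlong (1 : ℂ) (fun w => 𝒞.χ₁ w • γ (b - b₀) w) ξ)) =
        fun ξ => u₀ ξ + 𝒞.Ψ ξ (W ξ) := by
      funext ξ; exact 𝒞.fam_eq hr0 hr1 hJs hu₀.1 γ b ξ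
    have hgraphd : Differentiable ℝ fun y => 𝒞.Ψ y (W y) :=
      ((𝒞.hΨs.of_le (by simp : (1 : WithTop ℕ∞) ≤ ∞)).clm_apply W.contDiff).differentiable
        one_ne_zero
    have hderiv : ∀ ξ, fderiv ℝ (fun ξ => u₀ ξ + 𝒞.Ψ ξ (((0 : ℂ), b - b₀) +
        cauchyTransformAlong (1 : ℂ) (fun w => 𝒞.χ₁ w • γ (b - b₀) w) ξ)) ξ - fderiv ℝ u₀ ξ =
        fderiv ℝ (fun y => 𝒞.Ψ y (W y)) ξ := by
      intro ξ
      have h : HasFDerivAt (fun y => u₀ y + 𝒞.Ψ y (W y))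
          (fderiv ℝ u₀ ξ + fderiv ℝ (fun y => 𝒞.Ψ y (W y)) ξ) ξ :=
        ((hu₀s.differentiable (by simp)) ξ).hasFDerivAt.add (hgraphd ξ).hasFDerivAt
      rw [hfam, h.fderiv]
      abel
    refine ⟨fun ξ => ?_, fun ξ hξ => ?_, fun ξ hξ ξ' hξ' => ?_⟩
    · have hξ : u₀ ξ + 𝒞.Ψ ξ (((0 : ℂ), b - b₀) +
          cauchyTransformAlong (1 : ℂ) (fun w => 𝒞.χ₁ w • γ (b - b₀) w) ξ) =
          u₀ ξ + 𝒞.Ψ ξ (W ξ) := congrFun hfam ξ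
      beta_reduce
      rw [hξ]
      simpa using (hG0 ξ).trans hWK
    · rw [hderiv]; exact (hG1 ξ hξ).trans hWK
    · rw [hderiv, hderiv]
      calc _ ≤ K * ‖W‖ * ‖ξ - ξ'‖ ^ (r : ℝ) := hG2 ξ hξ ξ' hξ'
        _ ≤ θ * ‖ξ - ξ'‖ ^ (r : ℝ) := by gcongr
  · -- absorption
    refine ⟨θM, hθM, fun b hb u hu hsup hC1 hHol => ?_⟩
    rw [mem_ball, dist_eq_norm] at hb
    set β := b - b₀ with hβ_def
    have hbb : b₀ + β = b := by rw [hβ_def]; abel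
    rw [← hbb] at hu
    obtain ⟨g, hgn, -, -, hrep, hzeq⟩ := hMZ β u hu (hb.trans_le hεθM) hsup hC1 hHol
    -- `(β, g)` is a small zero of the vorticity map, hence `g = γ β`
    have hGz : D.G hr1.le (β, g) = 0 := by
      refine ContDiffHolderFunction.ext fun x => ?_
      rw [hD, helper_chartVorticityApply]
      simpa using hzeq x
    have hgγ : g = γ β := hγuniq β (by rw [mem_ball, dist_zero_right]; exact hb.trans_le hεε₀) g
      (by rw [mem_ball, dist_zero_right]; linarith) hGz
    funext ξ
    rw [hrep ξ, hgγ]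

end Summit.SmoothPoincare4.SmoothPoincare4.Cruxes.TameOrBrodyR4.Sketch
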